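import Summits.ABC.IUTFork.Repair.RHReqsideWeightLawsThreshold
import HarnessLib

/-!
# ROUND-4 row R4-1 «CHEAP DISCRIMINATOR» — the ONE-SIDEDNESS face: every κ₁ door's dilation factor is `≥ 1/μ₀ ≥ 1`

abc-iut cell, rung LADDER-ABC:A2.RESCUE.H; seat abc-iut-rh2-xi-1 g11 (KEY R4DISC-B, engine B of the R4-1 discriminator; memo
`plan/rescue/R-H/ROUND4/R4-1-DISCRIMINATOR-rh2-xi-1.md` §2.5, concurred by engine A abc-iut-rh-kit-1 `…-rh-kit-1.md` §1.4 LEMMA G and by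
referee abc-iut-rh-ref-1 14:16:24Z). CURRENCY = abc-iut-reqb-typ-1's `RH.ReqsideWeightLaws` (p508156): a κ₁ door (κ′, μ₀) of the
OPENINGS-CENSUS (rows O-01…O-05: κ′ ∈ {1, 3/2} = `lawPow 2`, `lawPow 3`; print = `lawPow 4`; target `0 < μ₀ ≤ 1`) hands downstream
print's own display DILATED by `Λ(κ′,μ₀,l) = D_{j²}(l⋆)/(μ₀·D_f(l⋆))`, `D_f(n) = demandSum f 1 n` (both engines' derivation, `uConst`
ratio). This file proves the arithmetic that makes the discriminator ONE-SIDED: `D_f ≤ D_{j²}` termwise for every κ-law of exponent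
index `a ≤ 4` (§1), hence `Λ ≥ 1/μ₀ ≥ 1` (§2), hence «LEMMA G»: a datum satisfying print's inequality `Q ≤ B` with `B ≥ 0` satisfies
every door's `Q ≤ Λ·B` (§3); §4 pins the worked level `l = 7` (`l⋆ = 3`): `D₁ = 3`, `D_{3/2} = 7`, `D₂ = 11`, i.e. `Λ = 11/(3μ₀)`,
`11/(7μ₀)`. Nothing here is a statement about IUT or about any datum; the numbers of the discriminator (0 violations, minimum margins)
are kit/seat computations recorded in the memo, computed ≠ proved. HONEST FRAMING: a «door» is a claim-tagged hypothesis in OUR typed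
cell currency; nothing asserts abc proved or refuted; no side on [IUTchIII] Cor. 3.12 / [IUTchIV] Thm. 1.10 or any author; typed ≠ proved.
[cite: Mochizuki2012, IUTchIV Thm. 1.10 Step (v) p. 27–29] [claim: Mochizuki2012, status: disputed] for every IUT locution.
-/

noncomputable section

namespace Summit.ABC.IUTFork.Repair.RH.R4Discriminator

open Summit.ABC.IUTFork.Repair.RH.ReqsideWeightLaws

/-! ## §1. The demand sum of every κ-law with `κ′ ≤ 2` is below print's -/

/-- **`D_f ≤ D_{j²}`**: for every κ-law `lawPow a` with exponent index `a ≤ 4` (`κ′ = a/2 ≤ 2`; the census doors have `a ∈ {2, 3}`)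
and every `n`, `demandSum (lawPow a) 1 n ≤ demandSum (lawPow 4) 1 n`. [folklore] -/
theorem demandSum_lawPow_le_four {a : ℕ} (ha : a ≤ 4) (n : ℕ) :
    demandSum (lawPow a) 1 n ≤ demandSum (lawPow 4) 1 n :=
  demandSum_mono (fun _ hj => lawPow_mono_exp hj ha) 1 n

/-- Monotonicity in the exponent index in general: `a ≤ b ⟹ D_{lawPow a} ≤ D_{lawPow b}`. [folklore] -/
theorem demandSum_lawPow_mono {a b : ℕ} (hab : a ≤ b) (n : ℕ) :
    demandSum (lawPow a) 1 n ≤ demandSum (lawPow b) 1 n :=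
  demandSum_mono (fun _ hj => lawPow_mono_exp hj hab) 1 n

/-- The `κ′ = 1` demand sum is `n(n−1)/2` (`lawPow 2 = j`). [folklore] -/
theorem two_mul_demandSum_lawPow_two (n : ℕ) : 2 * demandSum (lawPow 2) 1 n = (n : ℤ) * (n - 1) := by
  rw [demandSum_congr (f := lawPow 2) (g := fun j => (j : ℤ)) (fun j _ => lawPow_two j) 1 n]
  exact two_mul_demandSum_id n

/-- **Positivity**: for `a ≥ 2` and `n ≥ 2` the demand sum is positive (so `Λ` is well defined). [folklore] -/
theorem demandSum_lawPow_pos {a : ℕ} (ha : 2 ≤ a) {n : ℕ} (hn : 2 ≤ n) : 0 < demandSum (lawPow a) 1 n := by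
  have h1 : demandSum (lawPow 2) 1 n ≤ demandSum (lawPow a) 1 n := demandSum_lawPow_mono ha n
  have h2 : 2 * demandSum (lawPow 2) 1 n = (n : ℤ) * (n - 1) := two_mul_demandSum_lawPow_two n
  have hn' : (2 : ℤ) ≤ n := by exact_mod_cast hn
  nlinarith

/-! ## §2. The dilation factor `Λ = D₂/(μ₀·D_f)` is at least `1/μ₀ ≥ 1` -/

/-- **`1/μ₀ ≤ Λ`**: with `0 < μ₀`, `0 < D_f ≤ D₂`, `D₂/(μ₀·D_f) ≥ 1/μ₀`. [folklore] -/
theorem inv_le_dilation {μ₀ Df D₂ : ℝ} (hμ : 0 < μ₀) (hDf : 0 < Df) (hle : Df ≤ D₂) :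
    1 / μ₀ ≤ D₂ / (μ₀ * Df) := by
  rw [div_le_div_iff₀ hμ (mul_pos hμ hDf)]
  nlinarith

/-- **`1 ≤ Λ`**: with moreover `μ₀ ≤ 1`. [folklore] -/
theorem one_le_dilation {μ₀ Df D₂ : ℝ} (hμ : 0 < μ₀) (hμ1 : μ₀ ≤ 1) (hDf : 0 < Df) (hle : Df ≤ D₂) :
    1 ≤ D₂ / (μ₀ * Df) := by
  have h1 : 1 ≤ 1 / μ₀ := by rw [le_div_iff₀ hμ]; linarith
  exact h1.trans (inv_le_dilation hμ hDf hle)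

/-- The integer-to-real bridge for the census doors: `a ∈ {2, 3}` (indeed any `2 ≤ a ≤ 4`), `n ≥ 2`, `0 < μ₀ ≤ 1` ⟹
`1 ≤ (demandSum (lawPow 4) 1 n : ℝ) / (μ₀ · demandSum (lawPow a) 1 n)`. [folklore] -/
theorem one_le_dilation_lawPow {a n : ℕ} (ha2 : 2 ≤ a) (ha4 : a ≤ 4) (hn : 2 ≤ n) {μ₀ : ℝ} (hμ : 0 < μ₀) (hμ1 : μ₀ ≤ 1) :
    1 ≤ ((demandSum (lawPow 4) 1 n : ℤ) : ℝ) / (μ₀ * ((demandSum (lawPow a) 1 n : ℤ) : ℝ)) := by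
  have hpos : (0 : ℝ) < ((demandSum (lawPow a) 1 n : ℤ) : ℝ) := by exact_mod_cast demandSum_lawPow_pos ha2 hn
  have hle : ((demandSum (lawPow a) 1 n : ℤ) : ℝ) ≤ ((demandSum (lawPow 4) 1 n : ℤ) : ℝ) := by
    exact_mod_cast demandSum_lawPow_le_four ha4 n
  exact one_le_dilation hμ hμ1 hpos hle

/-! ## §3. «LEMMA G»: print's inequality implies every door's dilated one -/

/-- **LEMMA G** (engine A §1.4 / engine B §2.5): `1 ≤ Λ`, `0 ≤ B`, `Q ≤ B` ⟹ `Q ≤ Λ·B`. So a datum satisfying print's shape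
satisfies every κ₁ door's; only data violating print's by the factor `Λ` can violate a door's. [folklore] -/
theorem le_dilated_of_le {Q B Λ : ℝ} (hΛ : 1 ≤ Λ) (hB : 0 ≤ B) (h : Q ≤ B) : Q ≤ Λ * B := by
  nlinarith

/-- Contrapositive bookkeeping: a door violation `Λ·B < Q` with `1 ≤ Λ`, `0 ≤ B` forces the print ratio bound `B < Q`
(and indeed `Λ·B < Q`). [folklore] -/
theorem lt_of_dilated_lt {Q B Λ : ℝ} (hΛ : 1 ≤ Λ) (hB : 0 ≤ B) (h : Λ * B < Q) : B < Q := by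
  nlinarith

/-! ## §4. The worked level `l = 7` (`l⋆ = 3`): `D₁ = 3`, `D_{3/2} = 7`, `D₂ = 11` -/

/-- `demandSum (lawPow 2) 1 3 = 3` (`(1−1)+(2−1)+(3−1)`). [folklore] -/
theorem demandSum_lawPow_two_three : demandSum (lawPow 2) 1 3 = 3 := by
  have h := two_mul_demandSum_lawPow_two 3
  push_cast at h
  omega

/-- `demandSum (lawPow 4) 1 3 = 11` (`0 + 3 + 8`). [folklore] -/
theorem demandSum_lawPow_four_three : demandSum (lawPow 4) 1 3 = 11 := by
  have h := six_mul_demandSum_sq 3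
  rw [← demandSum_congr (f := lawPow 4) (g := fun j => (j : ℤ) ^ 2) (fun j _ => lawPow_four j) 1 3] at h
  push_cast at h
  omega

/-- `⌈2^{3/2}⌉ = 3` and `⌈3^{3/2}⌉ = 6` as `lawPow 3` values (`ceilSqrt 8 = 3`, `ceilSqrt 27 = 6`). [folklore] -/
theorem lawPow_three_two_three : lawPow 3 2 = 3 ∧ lawPow 3 3 = 6 := by
  refine ⟨?_, ?_⟩
  · apply le_antisymm (lawPow_le_of_pow_le_sq (by norm_num)) (succ_le_lawPow_of_sq_lt (s := 2) (by norm_num))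
  · apply le_antisymm (lawPow_le_of_pow_le_sq (by norm_num)) (succ_le_lawPow_of_sq_lt (s := 5) (by norm_num))

/-- `demandSum (lawPow 3) 1 3 = 7` (`0 + 2 + 5`). [folklore] -/
theorem demandSum_lawPow_three_three : demandSum (lawPow 3) 1 3 = 7 := by
  rw [demandSum_succ, demandSum_succ, demandSum_succ]
  simp only [demandSum, Finset.range_zero, Finset.sum_empty]
  rw [lawPow_at_one, lawPow_three_two_three.1, lawPow_three_two_three.2]
  norm_num

/-- **The five doors at `l = 7`**: `Λ(O-0n, 7) = 11/(3μ₀)` for `κ′ = 1` (`704/81`, `22/3`, `44/9` at `μ₀ = 27/64, 1/2, 3/4`) and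
`11/(7μ₀)` for `κ′ = 3/2` (`704/189`, `22/7` at `μ₀ = 27/64, 1/2`) — the smallest dilation over the census doors at `l ≥ 7` is `22/7`.
[folklore] -/
theorem dilation_values_seven :
    ((demandSum (lawPow 4) 1 3 : ℤ) : ℝ) / ((27 / 64 : ℝ) * (demandSum (lawPow 2) 1 3 : ℤ)) = 704 / 81 ∧
    ((demandSum (lawPow 4) 1 3 : ℤ) : ℝ) / ((1 / 2 : ℝ) * (demandSum (lawPow 2) 1 3 : ℤ)) = 22 / 3 ∧
    ((demandSum (lawPow 4) 1 3 : ℤ) : ℝ) / ((3 / 4 : ℝ) * (demandSum (lawPow 2) 1 3 : ℤ)) = 44 / 9 ∧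
    ((demandSum (lawPow 4) 1 3 : ℤ) : ℝ) / ((27 / 64 : ℝ) * (demandSum (lawPow 3) 1 3 : ℤ)) = 704 / 189 ∧
    ((demandSum (lawPow 4) 1 3 : ℤ) : ℝ) / ((1 / 2 : ℝ) * (demandSum (lawPow 3) 1 3 : ℤ)) = 22 / 7 := by
  rw [demandSum_lawPow_four_three, demandSum_lawPow_two_three, demandSum_lawPow_three_three]
  norm_num

end Summit.ABC.IUTFork.Repair.RH.R4Discriminator

end
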